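import Literature.NumberTheory.Automorphic.OrdinaryPartOfFiniteModule
import Literature.NumberTheory.Automorphic.OrdinaryPartOfFiniteModuleProd
import Mathlib.RingTheory.AdicCompletion.Basic
import Mathlib.RingTheory.Artinian.Module
import HarnessLib

/-!
# The ordinary part `⋂ₙ range Uⁿ` of an adically complete module with finite truncations

Topic `NumberTheory/Automorphic`; namespace `Literature.NumberTheory.Automorphic`; definitions with
bodies and theorems.  Hida's ordinary projector `e = lim U^{n!}` in the form the `p`-adic (as opposed
to `p^s`-torsion) statements of Hida theory need it ([Hida1994AIF, §2–3]; [KhareThorne2017, §2.4,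
§6.4]): for an `R`-module `M` which is `I`-adically complete (`IsAdicComplete I M`) with FINITE
truncations `M ⧸ IⁿM` (e.g. `M = H^q(Y, V(𝒪))` finitely generated over `𝒪 = ℤ_p`-finite, `I = (p)`)
and an endomorphism `U`:

* levelwise (`truncEnd I U n` on `M ⧸ IⁿM`, finite): Fitting's lemma — `ordMod`/`nilMod`, `IsCompl`
  (`isCompl_nilMod_ordMod`), `U` bijective on `ordMod` (`bijOn_ordMod`), and the transition maps
  map `ordMod (n') ↠ ordMod n` ONTO (`factorPow_surjOn_ordMod`);
* **`mem_ordPart_iff`: `x ∈ ⋂ₖ range Uᵏ ↔` every truncation of `x` is ordinary**;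
* **`bijOn_ordPart`: `U` restricts to a bijection of `M^{ord} = ⋂ₖ range Uᵏ`**;
* **`isCompl_nilPart_ordPart`: `M = M^{nil} ⊕ M^{ord}`** with
  `M^{nil} = {x | ∀ n ∃ k, Uᵏ x ∈ IⁿM}` (`mem_nilPart_iff_tendsto`), i.e. `M^{ord} = e M` for Hida's
  idempotent;
* **`map_mkQ_ordPart`: `M^{ord} ↠ (M ⧸ IⁿM)^{ord}`** — taking ordinary parts commutes with
  reduction (the module-theoretic control statement);
* `ordPart_noncommProd_eq_iInf`: for commuting `U_i`, `⋂ₖ range (∏ U_i)ᵏ = ⋂_i ⋂ₖ range U_iᵏ`.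

## References

* H. Hida, Ann. Inst. Fourier 44 (1994), §2 (held). [Hida1994AIF]
* C. Khare, J. A. Thorne, Amer. J. Math. 139 (2017), §2.4 Lemma 2.10, §6.4 (arXiv:1409.7007, held).
  [KhareThorne2017]
-/

namespace Literature.NumberTheory.Automorphic

open Submodule

variable {R M : Type*} [CommRing R] [AddCommGroup M] [Module R M] (I : Ideal R) (φ : Module.End R M)

/-! ### The truncations `M ⧸ IⁿM` and the induced endomorphisms -/

/-- `U (IⁿM) ⊆ IⁿM`. [folklore] -/
theorem pow_smul_top_le_comap (n : ℕ) :
    (I ^ n • ⊤ : Submodule R M) ≤ (I ^ n • ⊤ : Submodule R M).comap φ := by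
  refine Submodule.smul_le.2 fun r hr m _ => ?_
  rw [Submodule.mem_comap, map_smul]
  exact Submodule.smul_mem_smul hr Submodule.mem_top

/-- **`U mod Iⁿ`**, the endomorphism of `M ⧸ IⁿM` induced by `U`. [folklore] -/
def truncEnd (n : ℕ) : Module.End R (M ⧸ (I ^ n • ⊤ : Submodule R M)) :=
  (I ^ n • ⊤ : Submodule R M).mapQ (I ^ n • ⊤ : Submodule R M) φ (pow_smul_top_le_comap I φ n)

/-- `truncEnd` on classes. [folklore] -/
@[simp]
theorem modPow_mk (n : ℕ) (x : M) :
    truncEnd I φ n (Submodule.Quotient.mk x) = Submodule.Quotient.mk (φ x) :=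
  rfl

/-- Powers of `truncEnd` on classes. [folklore] -/
theorem modPow_pow_mk (n k : ℕ) (x : M) :
    (truncEnd I φ n ^ k) (Submodule.Quotient.mk x) =
      (Submodule.Quotient.mk ((φ ^ k) x) : M ⧸ (I ^ n • ⊤ : Submodule R M)) := by
  induction k with
  | zero => rfl
  | succ k ih => rw [pow_succ', pow_succ', Module.End.mul_apply, ih, modPow_mk, Module.End.mul_apply]

/-- `truncEnd` is multiplicative in `U`. [folklore] -/
theorem modPow_mul (ψ : Module.End R M) (n : ℕ) : truncEnd I (φ * ψ) n = truncEnd I φ n * truncEnd I ψ n := by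
  refine LinearMap.ext fun y => ?_
  obtain ⟨x, rfl⟩ := Submodule.Quotient.mk_surjective _ y
  rfl

/-- `truncEnd` of `1`. [folklore] -/
theorem modPow_one (n : ℕ) : truncEnd I (1 : Module.End R M) n = 1 := by
  refine LinearMap.ext fun y => ?_
  obtain ⟨x, rfl⟩ := Submodule.Quotient.mk_surjective _ y
  rfl

/-- `U ↦ U mod Iⁿ` as a monoid homomorphism. [folklore] -/
def truncEndHom (n : ℕ) : Module.End R M →* Module.End R (M ⧸ (I ^ n • ⊤ : Submodule R M)) where
  toFun ψ := truncEnd I ψ n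
  map_one' := modPow_one I n
  map_mul' ψ ψ' := modPow_mul I ψ ψ' n

/-- Unfolding `truncEndHom`. [folklore] -/
@[simp]
theorem modPowHom_apply (n : ℕ) (ψ : Module.End R M) : truncEndHom I n ψ = truncEnd I ψ n :=
  rfl

/-- The transition maps commute with the induced endomorphisms. [folklore] -/
theorem factorPow_modPow_pow {m n : ℕ} (h : m ≤ n) (k : ℕ) (y : M ⧸ (I ^ n • ⊤ : Submodule R M)) :
    factorPow I M h ((truncEnd I φ n ^ k) y) = (truncEnd I φ m ^ k) (factorPow I M h y) := by
  obtain ⟨x, rfl⟩ := Submodule.Quotient.mk_surjective _ y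
  rw [modPow_pow_mk]
  exact (modPow_pow_mk I φ m k x).symm

/-! ### Levelwise ordinary and nilpotent parts (Fitting) -/

/-- **`(M ⧸ IⁿM)^{ord} = ⋂ₖ range (U mod Iⁿ)ᵏ`.** [cite: KhareThorne2017, §2.4 Lemma 2.10] -/
def ordMod (n : ℕ) : Submodule R (M ⧸ (I ^ n • ⊤ : Submodule R M)) :=
  ⨅ k : ℕ, LinearMap.range (truncEnd I φ n ^ k)

/-- **`(M ⧸ IⁿM)^{nil} = ⋃ₖ ker (U mod Iⁿ)ᵏ`.** [cite: KhareThorne2017, §2.4 Lemma 2.10] -/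
def nilMod (n : ℕ) : Submodule R (M ⧸ (I ^ n • ⊤ : Submodule R M)) :=
  ⨆ k : ℕ, LinearMap.ker (truncEnd I φ n ^ k)

/-- Membership in `nilMod`: some power kills the class. [folklore] -/
theorem mem_nilMod_iff (n : ℕ) (y : M ⧸ (I ^ n • ⊤ : Submodule R M)) :
    y ∈ nilMod I φ n ↔ ∃ k : ℕ, (truncEnd I φ n ^ k) y = 0 := by
  have hdir : Directed (· ≤ ·) fun k : ℕ => LinearMap.ker (truncEnd I φ n ^ k) :=
    (truncEnd I φ n).iterateKer.monotone.directed_le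
  rw [nilMod, Submodule.mem_iSup_of_directed _ hdir]
  simp only [LinearMap.mem_ker]

/-- The transition maps preserve ordinary parts. [folklore] -/
theorem factorPow_mem_ordMod {m n : ℕ} (h : m ≤ n) {y : M ⧸ (I ^ n • ⊤ : Submodule R M)}
    (hy : y ∈ ordMod I φ n) : factorPow I M h y ∈ ordMod I φ m := by
  simp only [ordMod, Submodule.mem_iInf, LinearMap.mem_range] at hy ⊢
  intro k
  obtain ⟨z, hz⟩ := hy k
  exact ⟨factorPow I M h z, by rw [← factorPow_modPow_pow, hz]⟩

/-- The transition maps preserve nilpotent parts. [folklore] -/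
theorem factorPow_mem_nilMod {m n : ℕ} (h : m ≤ n) {y : M ⧸ (I ^ n • ⊤ : Submodule R M)}
    (hy : y ∈ nilMod I φ n) : factorPow I M h y ∈ nilMod I φ m := by
  rw [mem_nilMod_iff] at hy ⊢
  obtain ⟨k, hk⟩ := hy
  exact ⟨k, by rw [← factorPow_modPow_pow, hk, map_zero]⟩

section Finite

variable [hfin : ∀ n : ℕ, Finite (M ⧸ (I ^ n • ⊤ : Submodule R M))]

/-- **Fitting at level `n`: `M ⧸ IⁿM = nil ⊕ ord`.** [cite: KhareThorne2017, §2.4 Lemma 2.10] -/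
theorem isCompl_nilMod_ordMod (n : ℕ) : IsCompl (nilMod I φ n) (ordMod I φ n) := by
  haveI : IsArtinian R (M ⧸ (I ^ n • ⊤ : Submodule R M)) := isArtinian_of_finite
  exact (truncEnd I φ n).isCompl_iSup_ker_pow_iInf_range_pow

/-- `U mod Iⁿ` is bijective on the levelwise ordinary part. [folklore] -/
theorem bijOn_ordMod (n : ℕ) :
    Set.BijOn (truncEnd I φ n) (ordMod I φ n : Set (M ⧸ (I ^ n • ⊤ : Submodule R M))) (ordMod I φ n) :=
  bijOn_iInf_range_pow _

/-- So are its powers. [folklore] -/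
theorem bijOn_ordMod_pow (n k : ℕ) :
    Set.BijOn (truncEnd I φ n ^ k) (ordMod I φ n : Set (M ⧸ (I ^ n • ⊤ : Submodule R M))) (ordMod I φ n) := by
  induction k with
  | zero =>
    rw [pow_zero, Module.End.one_eq_id, LinearMap.id_coe]
    exact Set.bijOn_id _
  | succ k ih =>
    rw [pow_succ, Module.End.mul_eq_comp, LinearMap.coe_comp]
    exact ih.comp (bijOn_ordMod I φ n)

/-- **The transition maps send `(M ⧸ I^{n'}M)^{ord}` ONTO `(M ⧸ IⁿM)^{ord}`.** [folklore] -/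
theorem factorPow_surjOn_ordMod {m n : ℕ} (h : m ≤ n) :
    Set.SurjOn (factorPow I M h) (ordMod I φ n : Set (M ⧸ (I ^ n • ⊤ : Submodule R M))) (ordMod I φ m) := by
  intro y hy
  obtain ⟨x, rfl⟩ := Submodule.Quotient.mk_surjective _ y
  obtain ⟨u, hu, o, ho, huo⟩ := Submodule.mem_sup.1
    (show (Submodule.Quotient.mk x : M ⧸ (I ^ n • ⊤ : Submodule R M)) ∈ nilMod I φ n ⊔ ordMod I φ n by
      rw [(isCompl_nilMod_ordMod I φ n).sup_eq_top]; exact Submodule.mem_top)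
  refine ⟨o, ho, ?_⟩
  have hsum : factorPow I M h u + factorPow I M h o = Submodule.Quotient.mk x := by
    rw [← map_add, huo]
    rfl
  have hu' : factorPow I M h u ∈ ordMod I φ m := by
    rw [eq_sub_of_add_eq hsum]
    exact sub_mem hy (factorPow_mem_ordMod I φ h ho)
  have hu0 : factorPow I M h u = 0 :=
    (Submodule.disjoint_def.1 (isCompl_nilMod_ordMod I φ m).disjoint) _ (factorPow_mem_nilMod I φ h hu) hu'
  rw [← hsum, hu0, zero_add]

end Finite

/-! ### The ordinary part of `M` -/

/-- **`M^{ord} = ⋂ₖ range Uᵏ`** (the image of Hida's idempotent `e = lim U^{n!}` when it exists).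
[cite: Hida1994AIF, §2] [cite: KhareThorne2017, §2.4] -/
def ordPart : Submodule R M :=
  ⨅ k : ℕ, LinearMap.range (φ ^ k)

/-- **`M^{nil}`**: the elements all of whose truncations are `U`-nilpotent. [cite: KhareThorne2017, §2.4] -/
def nilPart : Submodule R M :=
  ⨅ n : ℕ, (nilMod I φ n).comap (I ^ n • ⊤ : Submodule R M).mkQ

/-- Membership in `nilPart`. [folklore] -/
theorem mem_nilPart_iff (x : M) :
    x ∈ nilPart I φ ↔ ∀ n : ℕ, (Submodule.Quotient.mk x : M ⧸ (I ^ n • ⊤ : Submodule R M)) ∈ nilMod I φ n := by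
  simp only [nilPart, Submodule.mem_iInf, Submodule.mem_comap, Submodule.mkQ_apply]

/-- **`x ∈ M^{nil} ↔ ∀ n ∃ k, Uᵏ x ∈ IⁿM`** (`Uᵏ x → 0` `I`-adically). [folklore] -/
theorem mem_nilPart_iff_tendsto (x : M) :
    x ∈ nilPart I φ ↔ ∀ n : ℕ, ∃ k : ℕ, (φ ^ k) x ∈ (I ^ n • ⊤ : Submodule R M) := by
  rw [mem_nilPart_iff]
  refine forall_congr' fun n => ?_
  rw [mem_nilMod_iff]
  refine exists_congr fun k => ?_
  rw [modPow_pow_mk, Submodule.Quotient.mk_eq_zero]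

/-- Truncations of ordinary elements are ordinary. [folklore] -/
theorem mk_mem_ordMod (n : ℕ) {x : M} (hx : x ∈ ordPart φ) :
    (Submodule.Quotient.mk x : M ⧸ (I ^ n • ⊤ : Submodule R M)) ∈ ordMod I φ n := by
  simp only [ordPart, ordMod, Submodule.mem_iInf, LinearMap.mem_range] at hx ⊢
  intro k
  obtain ⟨y, hy⟩ := hx k
  exact ⟨Submodule.Quotient.mk y, by rw [modPow_pow_mk, hy]⟩

/-- Completeness: compatible families of truncations lift. [folklore] -/
theorem exists_forall_mk_eq [IsPrecomplete I M] (a : ∀ n : ℕ, M ⧸ (I ^ n • ⊤ : Submodule R M))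
    (ha : ∀ {m n : ℕ} (h : m ≤ n), factorPow I M h (a n) = a m) :
    ∃ x : M, ∀ n, (Submodule.Quotient.mk x : M ⧸ (I ^ n • ⊤ : Submodule R M)) = a n := by
  obtain ⟨x, hx⟩ := AdicCompletion.of_surjective I M ⟨a, fun h => ha h⟩
  refine ⟨x, fun n => ?_⟩
  have h := congrArg (fun f : AdicCompletion I M => f.val n) hx
  simpa only [AdicCompletion.of_apply, Submodule.mkQ_apply] using h

/-- Separatedness: elements with equal truncations are equal. [folklore] -/
theorem eq_of_forall_mk_eq [IsHausdorff I M] {x y : M}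
    (h : ∀ n : ℕ, (Submodule.Quotient.mk x : M ⧸ (I ^ n • ⊤ : Submodule R M)) = Submodule.Quotient.mk y) :
    x = y :=
  IsHausdorff.eq_iff_smodEq.2 h

section Complete

variable [IsAdicComplete I M] [hfin : ∀ n : ℕ, Finite (M ⧸ (I ^ n • ⊤ : Submodule R M))]

include I

/-- **Key lifting lemma**: an element all of whose truncations are ordinary has, for every `k`, a
`Uᵏ`-preimage in `M^{ord}`. [cite: Hida1994AIF, §2] -/
theorem exists_mem_ordPart_pow_apply_eq {x : M}
    (hx : ∀ n : ℕ, (Submodule.Quotient.mk x : M ⧸ (I ^ n • ⊤ : Submodule R M)) ∈ ordMod I φ n) (k : ℕ) :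
    ∃ y ∈ ordPart φ, (φ ^ k) y = x := by
  have hex : ∀ n : ℕ, ∃ a ∈ ordMod I φ n, (truncEnd I φ n ^ k) a = Submodule.Quotient.mk x :=
    fun n => (bijOn_ordMod_pow I φ n k).surjOn (hx n)
  choose a ha hak using hex
  have hcompat : ∀ {m n : ℕ} (h : m ≤ n), factorPow I M h (a n) = a m := by
    intro m n h
    refine (bijOn_ordMod_pow I φ m k).injOn (factorPow_mem_ordMod I φ h (ha n)) (ha m) ?_
    rw [← factorPow_modPow_pow, hak n, hak m]
    rfl
  obtain ⟨y, hy⟩ := exists_forall_mk_eq I a hcompat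
  have hyx : (φ ^ k) y = x := eq_of_forall_mk_eq I fun n => by rw [← modPow_pow_mk, hy n, hak n]
  refine ⟨y, ?_, hyx⟩
  -- `y` is ordinary: its truncations `a n` are, and we may lift again
  simp only [ordPart, Submodule.mem_iInf]
  intro l
  have hex' : ∀ n : ℕ, ∃ b ∈ ordMod I φ n, (truncEnd I φ n ^ l) b = a n :=
    fun n => (bijOn_ordMod_pow I φ n l).surjOn (ha n)
  choose b hb hbl using hex'
  have hcompat' : ∀ {m n : ℕ} (h : m ≤ n), factorPow I M h (b n) = b m := by
    intro m n h
    refine (bijOn_ordMod_pow I φ m l).injOn (factorPow_mem_ordMod I φ h (hb n)) (hb m) ?_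
    rw [← factorPow_modPow_pow, hbl n, hbl m, hcompat h]
  obtain ⟨z, hz⟩ := exists_forall_mk_eq I b hcompat'
  exact ⟨z, eq_of_forall_mk_eq I fun n => by rw [← modPow_pow_mk, hz n, hbl n, hy n]⟩

/-- **`x ∈ M^{ord} ↔ all truncations of x are ordinary.`** [cite: Hida1994AIF, §2] -/
theorem mem_ordPart_iff {x : M} :
    x ∈ ordPart φ ↔ ∀ n : ℕ, (Submodule.Quotient.mk x : M ⧸ (I ^ n • ⊤ : Submodule R M)) ∈ ordMod I φ n := by
  refine ⟨fun hx n => mk_mem_ordMod I φ n hx, fun hx => ?_⟩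
  simp only [ordPart, Submodule.mem_iInf]
  intro k
  obtain ⟨y, _, hy⟩ := exists_mem_ordPart_pow_apply_eq I φ hx k
  exact ⟨y, hy⟩

/-- `U` is injective on `M^{ord}`. [folklore] -/
theorem injOn_ordPart : Set.InjOn φ (ordPart φ : Set M) := fun x hx y hy hxy =>
  eq_of_forall_mk_eq I fun n => (bijOn_ordMod I φ n).injOn (mk_mem_ordMod I φ n hx) (mk_mem_ordMod I φ n hy)
    (by rw [modPow_mk, modPow_mk, hxy])

/-- `U` maps `M^{ord}` onto itself. [folklore] -/
theorem surjOn_ordPart : Set.SurjOn φ (ordPart φ : Set M) (ordPart φ) := fun x hx => by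
  obtain ⟨y, hy, hyx⟩ := exists_mem_ordPart_pow_apply_eq I φ (fun n => mk_mem_ordMod I φ n hx) 1
  exact ⟨y, hy, by rwa [pow_one] at hyx⟩

/-- **`U` restricts to a bijection of `M^{ord}`** (complete module with finite truncations).
[cite: Hida1994AIF, §2] [cite: KhareThorne2017, §2.4 Lemma 2.10] -/
theorem bijOn_ordPart : Set.BijOn φ (ordPart φ : Set M) (ordPart φ) :=
  ⟨mapsTo_iInf_range_pow_self φ, injOn_ordPart I φ, surjOn_ordPart I φ⟩

/-- **`M = M^{nil} ⊕ M^{ord}`** (Hida's ordinary decomposition `1 = (1 − e) + e`).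
[cite: Hida1994AIF, §2] [cite: KhareThorne2017, §2.4 Lemma 2.10] -/
theorem isCompl_nilPart_ordPart : IsCompl (nilPart I φ) (ordPart φ) := by
  refine ⟨Submodule.disjoint_def.2 fun x hxn hxo => ?_, codisjoint_iff.2 (Submodule.eq_top_iff'.2 fun x => ?_)⟩
  · refine eq_of_forall_mk_eq I fun n => ?_
    rw [Submodule.Quotient.mk_zero]
    exact Submodule.disjoint_def.1 (isCompl_nilMod_ordMod I φ n).disjoint _ ((mem_nilPart_iff I φ x).1 hxn n)
      (mk_mem_ordMod I φ n hxo)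
  · have hex : ∀ n : ℕ, ∃ o ∈ ordMod I φ n,
        (Submodule.Quotient.mk x : M ⧸ (I ^ n • ⊤ : Submodule R M)) - o ∈ nilMod I φ n := fun n => by
      obtain ⟨u, hu, o, ho, huo⟩ := Submodule.mem_sup.1
        (show (Submodule.Quotient.mk x : M ⧸ (I ^ n • ⊤ : Submodule R M)) ∈ nilMod I φ n ⊔ ordMod I φ n by
          rw [(isCompl_nilMod_ordMod I φ n).sup_eq_top]; exact Submodule.mem_top)
      exact ⟨o, ho, by rw [← huo, add_sub_cancel_right]; exact hu⟩
    choose o ho hxo using hex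
    have hcompat : ∀ {m n : ℕ} (h : m ≤ n), factorPow I M h (o n) = o m := by
      intro m n h
      have h1 : factorPow I M h (o n) ∈ ordMod I φ m := factorPow_mem_ordMod I φ h (ho n)
      have h2 : (Submodule.Quotient.mk x : M ⧸ (I ^ m • ⊤ : Submodule R M)) - factorPow I M h (o n) ∈
          nilMod I φ m := by
        have h2' := factorPow_mem_nilMod I φ h (hxo n)
        rw [map_sub] at h2'
        exact h2'
      have h3 : o m - factorPow I M h (o n) ∈ nilMod I φ m := by
        have h3' := sub_mem h2 (hxo m)
        rwa [sub_sub_sub_cancel_left] at h3'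
      have h4 : o m - factorPow I M h (o n) ∈ ordMod I φ m := sub_mem (ho m) h1
      exact (sub_eq_zero.1 (Submodule.disjoint_def.1 (isCompl_nilMod_ordMod I φ m).disjoint _ h3 h4)).symm
    obtain ⟨y, hy⟩ := exists_forall_mk_eq I o hcompat
    have hyo : y ∈ ordPart φ := (mem_ordPart_iff I φ).2 fun n => by rw [hy n]; exact ho n
    refine Submodule.mem_sup.2 ⟨x - y, (mem_nilPart_iff I φ _).2 fun n => ?_, y, hyo, sub_add_cancel x y⟩
    rw [Submodule.Quotient.mk_sub, hy n]
    exact hxo n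

/-- **Control for ordinary parts: `M^{ord} → (M ⧸ IⁿM)^{ord}` is onto**, i.e. the ordinary part of
the truncation is the truncation of the ordinary part. [cite: Hida1994AIF, §3] -/
theorem map_mkQ_ordPart (n : ℕ) :
    (ordPart φ).map (I ^ n • ⊤ : Submodule R M).mkQ = ordMod I φ n := by
  refine le_antisymm ?_ fun y hy => ?_
  · rintro _ ⟨x, hx, rfl⟩
    exact mk_mem_ordMod I φ n hx
  · -- extend `y` to a compatible family of ordinary truncations above level `n`
    have hstep : ∀ (j : ℕ) (z : ordMod I φ (n + j)), ∃ z' : ordMod I φ (n + j + 1),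
        factorPow I M (Nat.le_succ (n + j)) (z' : M ⧸ (I ^ (n + j + 1) • ⊤ : Submodule R M)) = z := fun j z => by
      obtain ⟨z', hz', h⟩ := factorPow_surjOn_ordMod I φ (Nat.le_succ (n + j)) z.2
      exact ⟨⟨z', hz'⟩, h⟩
    choose next hnext using hstep
    obtain ⟨b, hb0, hbsucc⟩ : ∃ b : ∀ j : ℕ, ordMod I φ (n + j), (b 0).1 = y ∧
        ∀ j, factorPow I M (Nat.le_succ (n + j)) (b (j + 1) : M ⧸ (I ^ (n + j + 1) • ⊤ : Submodule R M)) = b j :=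
      ⟨fun j => Nat.rec (motive := fun j => ordMod I φ (n + j)) ⟨y, hy⟩ (fun j z => next j z) j, rfl,
        fun j => hnext j _⟩
    have hbcompat : ∀ {j j' : ℕ} (h : j ≤ j'),
        factorPow I M (Nat.add_le_add_left h n) (b j' : M ⧸ (I ^ (n + j') • ⊤ : Submodule R M)) = b j := by
      intro j j' h
      exact (Submodule.eq_factor_of_eq_factor_succ (p := fun j => (I ^ (n + j) • ⊤ : Submodule R M))
        (fun j j' h => pow_smul_top_le I M (Nat.add_le_add_left h n)) (fun j => (b j : M ⧸ _))
        (fun j => (hbsucc j).symm) h).symm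
    let a : ∀ m : ℕ, M ⧸ (I ^ m • ⊤ : Submodule R M) := fun m => factorPow I M (Nat.le_add_left m n) (b m)
    have hacompat : ∀ {m m' : ℕ} (h : m ≤ m'), factorPow I M h (a m') = a m := by
      intro m m' h
      simp only [a]
      rw [← hbcompat h, ← LinearMap.comp_apply (f := factorPow I M h), factor_comp,
        ← LinearMap.comp_apply (f := factorPow I M (Nat.le_add_left m n)), factor_comp]
    obtain ⟨x, hx⟩ := exists_forall_mk_eq I a hacompat
    have hxo : x ∈ ordPart φ := (mem_ordPart_iff I φ).2 fun m => by
      rw [hx m]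
      exact factorPow_mem_ordMod I φ _ (b m).2
    refine ⟨x, hxo, ?_⟩
    rw [Submodule.mkQ_apply, hx n]
    exact (hbcompat (Nat.zero_le n)).trans hb0

/-- **Several commuting operators**: the ordinary part for `∏ U_i` is the intersection of the
ordinary parts (e.g. `U_p = ∏_{v ∣ p} U_v`). [cite: KhareThorne2017, §2.4] -/
theorem ordPart_noncommProd_eq_iInf {ι : Type*} (s : Finset ι) (T : ι → Module.End R M)
    (hcomm : (s : Set ι).Pairwise fun i j => Commute (T i) (T j)) :
    ordPart (s.noncommProd T hcomm) = ⨅ i ∈ s, ordPart (T i) := by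
  ext x
  simp only [Submodule.mem_iInf]
  rw [mem_ordPart_iff I]
  have hlevel : ∀ n : ℕ, ordMod I (s.noncommProd T hcomm) n = ⨅ i ∈ s, ordMod I (T i) n := by
    intro n
    have hcomm' : (s : Set ι).Pairwise fun i j => Commute (truncEnd I (T i) n) (truncEnd I (T j) n) :=
      fun i hi j hj hij => by
        change truncEnd I (T i) n * truncEnd I (T j) n = truncEnd I (T j) n * truncEnd I (T i) n
        rw [← modPow_mul, ← modPow_mul, (hcomm hi hj hij).eq]
    have hprod : truncEnd I (s.noncommProd T hcomm) n = s.noncommProd (fun i => truncEnd I (T i) n) hcomm' := by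
      rw [← modPowHom_apply, Finset.map_noncommProd]
      rfl
    rw [ordMod, hprod, iInf_range_pow_noncommProd_eq]
    rfl
  simp only [hlevel, Submodule.mem_iInf]
  constructor
  · intro h i hi
    exact (mem_ordPart_iff I (T i)).2 fun n => h n i hi
  · intro h n i hi
    exact mk_mem_ordMod I (T i) n (h i hi)

end Complete

end Literature.NumberTheory.Automorphic
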